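import Summits.QuantumFields.BalabanUV.Beta.GAN24.EffectiveFormLocalisationLatticeSoft

/-!
# `BalabanUV.Beta.GAN24.EffectiveFormLocalisationLatticeEnd` — binder row G-an2-4 ∕ (CONV-C), route R6 «VALUES, NOT DERIVATIVES», PART 110:
# S2′(h) ON THE ONE-STEP BLOCK LATTICE, II: THE ENDs — for every torus `(ℤ∕M)^d`, every orthogonal background `R, W` (comb letter) and every symmetric, squeezed,
# block-local fine form `H_f`, the EFFECTIVE FORM `𝒮 = effForm H_f Q` and the HARD MINIMISER `ℋ = minOp H_f Q` decay exponentially in the torus block distance: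
# `|𝒮(b,b′)| ≤ (2(Λ+a)+a)·e^{−r_U·tdist(b.1,b′.1)}`, `|ℋ(p,b)| ≤ 2(Λ+a)·|o|(2∕γ_K)·|o|K_d(m∕2)·e^{−(m∕2)·tdist(p.1.1,b.1)}` — PART 105's `abs_effForm_le` ∕ `abs_minOp_le` with
# EVERY letter discharged by PARTs 108 ∕ 109; the constants `Λ = 4d·w_f′·L^d`, `γ_K`, `r_F`, `c₀ = |o|²·2∕γ_K`, `r_U`, `m = min r_F r_U` are closed expressions in
# `(d, L, |o|, a, w_f, w_f′, h₀, δ_H)` (displayed as equations; instantiate with `rfl`) — neither `M` nor `R, W` enter (unit b2b-balaban-gan24-p3, gen 50; v1)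

NOT IN PRINT; OUR PROOF (for the ROUTE; [folklore] composition BY NAME of PART 105 (`abs_effForm_le`, `abs_minOp_le`), PART 108 (`ub_lattice`) and PART 109 (`coercive_K`,
`abs_blockProp_le_lattice`, `abs_Kinv_mul_transpose_le_lattice`, the torus bookkeeping)).  HONEST FRAMING (cell contract, verbatim): «discharging `BetaPertH` makes Bałaban's
UV stability UNCONDITIONAL — a real constructive-QFT result; it is NOT the continuum limit and NOT the Clay problem.»  HONEST DEPENDENCY (verbatim): «continuum YM on T⁴ ⇐
BetaPertH ∧ nine spine estimates (0/9 proved); BetaPertH ⇐ (D1) ∧ (D4) ∧ CAP+tail; G-an2-4 gates asym, D1 and NE2/3/4.»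
WHAT THIS FILE PROVES (0 sorry, 0 `def`, nothing cited): **`abs_effForm_le_lattice`**, **`abs_minOp_le_lattice`**.
HONEST: ONE block step, background-free and volume-free — an INSTANCE of S2′(h) on the lineage's own lattice (non-vacuity of PARTs 105 ∕ 108 ∕ 109's hypotheses, and the one-step
decay of `𝒮`, `ℋ` for every orthogonal background); NOT a k-uniform statement along Bałaban's tower, NOT his `Δ_a(U)` ([B9] (3.23)); SUPPLIER work on route C-R6° (rank 2,
REDUCTION); no consumer of record; NEVER «G-an2-4 closed»; NOT (CONV-C), NOT D1, NOT `BetaPertH`, NOT continuum, NOT Clay.  Records: `HOME/b2b-balaban-gan24-p3/gen50/README.md`.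
-/

noncomputable section

open scoped BigOperators Matrix
open Matrix Finset Function
open Literature.MathematicalPhysics.QuantumFieldTheory.Balaban1983to89
open Literature.MathematicalPhysics.QuantumFieldTheory.Balaban1983to89.B4Sect5Torus (IsPseudoDist SumBound rate rate_pos tdist tdist_symm tdist_self
  tdist_triangle tdist_nonneg)
open Literature.MathematicalPhysics.QuantumFieldTheory.Balaban1983to89.B4Sect5Proof (latticeConst latticeConst_nonneg)
open Literature.MathematicalPhysics.QuantumFieldTheory.Balaban1983to89.Beta.Composition (kkt blockProp)
open Literature.MathematicalPhysics.QuantumFieldTheory.Balaban1983to89.Beta.CompositionSingular (effForm minOp)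
open Summit.QuantumFields.BalabanUV.Beta.GAN24.EffectiveFormLocalisation (abs_effForm_le abs_minOp_le)
open Summit.QuantumFields.BalabanUV.Beta.GAN24.EffectiveFormLocalisationLatticeLetters (ub_lattice)
open Summit.QuantumFields.BalabanUV.Beta.GAN24.EffectiveFormLocalisationLatticeSoft (one_le_const isPseudoDist_unit sum_exp_unit_le tdist_fine_le_unit coercive_K
  gammaK_pos abs_blockProp_le_lattice abs_Kinv_mul_transpose_le_lattice)
open Summit.QuantumFields.BalabanUV.Beta.GAN24.DerivativeRateTransferJensenChain (dotProduct_self_nonneg')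

namespace Summit.QuantumFields.BalabanUV.Beta.GAN24.EffectiveFormLocalisationLatticeEnd

variable {d L M : ℕ} {o : Type*} [Fintype o] [DecidableEq o]
variable [NeZero M] [NeZero L]
variable {W : (Fin d → ZMod M) → (Fin d → ZMod M) × (Fin d → Fin L) → Matrix o o ℝ}
variable {Q : Matrix ((Fin d → ZMod M) × o) (((Fin d → ZMod M) × (Fin d → Fin L)) × o) ℝ}
variable {Hf : Matrix (((Fin d → ZMod M) × (Fin d → Fin L)) × o) (((Fin d → ZMod M) × (Fin d → Fin L)) × o) ℝ}

/-- **`abs_effForm_le_lattice` — THE EFFECTIVE FORM OF THE ONE-STEP BLOCK LATTICE IS LOCALISED, EVERY BACKGROUND, EVERY TORUS** [our proof; PART 105 `abs_effForm_le` with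
`hK` := PART 109 `coercive_K`, `hUB` := PART 108 `ub_lattice` (`Λ = 4d·w_f′·L^d`), `hP` := PART 109 `abs_blockProp_le_lattice`, the unit profile `|o|·K_d`]:
`|𝒮(b,b′)| ≤ (2(Λ+a)+a)·e^{−r_U·tdist(b.1,b′.1)}`, `r_U = rate (s ↦ |o|K_d(s)) (Λ+a)⁻¹ (|o|²·2∕γ_K) r_F`. -/
theorem abs_effForm_le_lattice (hL : 0 < L) {R : ((Fin d → ZMod M) × (Fin d → Fin L)) × Fin d → Matrix o o ℝ} (hR : ∀ e, (R e)ᵀ * R e = 1)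
    (hW : ∀ y x, (W y x)ᵀ * W y x = 1)
    (hWstep : ∀ (y : Fin d → ZMod M) (z : Fin d → Fin L) (μ : Fin d) (h : (z μ : ℕ) + 1 < L), (∀ ν, μ < ν → (z ν : ℕ) = 0) →
      W y (y, update z μ ⟨(z μ : ℕ) + 1, h⟩) = W y (y, z) * R ((y, z), μ))
    (hQ : ∀ (u : ((Fin d → ZMod M) × (Fin d → Fin L)) × o → ℝ) (y : Fin d → ZMod M),
      (fun a => (Q *ᵥ u) (y, a)) = ∑ x, (if x.1 = y then ((L : ℝ) ^ d)⁻¹ else 0) • (W y x *ᵥ fun b => u (x, b)))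
    (hHsym : Hfᵀ = Hf) {wf wf' : ℝ} (hwf : 0 < wf) (hwf' : 0 ≤ wf')
    (hHf : ∀ u : ((Fin d → ZMod M) × (Fin d → Fin L)) × o → ℝ,
      wf * ∑ e : ((Fin d → ZMod M) × (Fin d → Fin L)) × Fin d,
        ((R e *ᵥ fun b => u ((e.1.1 + ((((e.1.2 e.2 : ℕ) + 1) / L) • (Pi.single e.2 (1 : ZMod M))),
            update e.1.2 e.2 ⟨((e.1.2 e.2 : ℕ) + 1) % L, Nat.mod_lt _ hL⟩), b)) - fun b => u (e.1, b)) ⬝ᵥ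
          ((R e *ᵥ fun b => u ((e.1.1 + ((((e.1.2 e.2 : ℕ) + 1) / L) • (Pi.single e.2 (1 : ZMod M))),
            update e.1.2 e.2 ⟨((e.1.2 e.2 : ℕ) + 1) % L, Nat.mod_lt _ hL⟩), b)) - fun b => u (e.1, b)) ≤ u ⬝ᵥ (Hf *ᵥ u))
    (hHf' : ∀ u : ((Fin d → ZMod M) × (Fin d → Fin L)) × o → ℝ, u ⬝ᵥ (Hf *ᵥ u) ≤
      wf' * ∑ e : ((Fin d → ZMod M) × (Fin d → Fin L)) × Fin d,
        ((R e *ᵥ fun b => u ((e.1.1 + ((((e.1.2 e.2 : ℕ) + 1) / L) • (Pi.single e.2 (1 : ZMod M))),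
            update e.1.2 e.2 ⟨((e.1.2 e.2 : ℕ) + 1) % L, Nat.mod_lt _ hL⟩), b)) - fun b => u (e.1, b)) ⬝ᵥ
          ((R e *ᵥ fun b => u ((e.1.1 + ((((e.1.2 e.2 : ℕ) + 1) / L) • (Pi.single e.2 (1 : ZMod M))),
            update e.1.2 e.2 ⟨((e.1.2 e.2 : ℕ) + 1) % L, Nat.mod_lt _ hL⟩), b)) - fun b => u (e.1, b)))
    {a h₀ δH : ℝ} (ha : 0 < a) (hh₀ : 0 ≤ h₀) (hδH : 0 < δH)
    (hHent : ∀ p q : ((Fin d → ZMod M) × (Fin d → Fin L)) × o, |Hf p q| ≤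
      h₀ * Real.exp (-(δH * tdist (fun _ : Fin d => M) (fun i => (ZMod.finEquiv M).symm (p.1.1 i)) (fun i => (ZMod.finEquiv M).symm (q.1.1 i)))))
    {γK cK rF c₀ Λ rU : ℝ}
    (hγK : γK = (max (4 * (4 * (d * ((L : ℝ) - 1)) ^ 2 * (L : ℝ) ^ d / wf))
        ((16 * d * (4 * (d * ((L : ℝ) - 1)) ^ 2 * (L : ℝ) ^ d / wf) * wf' * (L : ℝ) ^ d + 2 * (L : ℝ) ^ d) / a))⁻¹)
    (hcK : cK = h₀ + a * Fintype.card o * (((L : ℝ) ^ d)⁻¹) ^ 2)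
    (hrF : rF = rate (fun s => Fintype.card o * (L : ℝ) ^ d * latticeConst d s) γK cK δH)
    (hc₀ : c₀ = (Fintype.card o : ℝ) ^ 2 * (2 / γK)) (hΛ : Λ = 4 * d * wf' * (L : ℝ) ^ d)
    (hrU : rU = rate (fun s => Fintype.card o * latticeConst d s) (Λ + a)⁻¹ c₀ rF)
    (b b' : (Fin d → ZMod M) × o) :
    |effForm Hf Q b b'| ≤ (2 * (Λ + a) + a) *
      Real.exp (-(rU * tdist (fun _ : Fin d => M) (fun i => (ZMod.finEquiv M).symm (b.1 i)) (fun i => (ZMod.finEquiv M).symm (b'.1 i)))) := by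
  have hγpos : 0 < γK := by rw [hγK]; exact gammaK_pos hL hwf hwf' ha
  have hcK0 : 0 ≤ cK := by rw [hcK]; positivity
  have hLd : 0 < (L : ℝ) ^ d := pow_pos (Nat.cast_pos.mpr hL) d
  have hprofF : ∀ s : ℝ, 0 < s → 0 ≤ Fintype.card o * (L : ℝ) ^ d * latticeConst d s := fun s hs => by
    have := latticeConst_nonneg d hs.le; positivity
  have hprofU : ∀ s : ℝ, 0 < s → 0 ≤ (Fintype.card o : ℝ) * latticeConst d s := fun s hs => by
    have := latticeConst_nonneg d hs.le; positivity
  have hrFpos : 0 < rF := by rw [hrF]; exact rate_pos hprofF hγpos hcK0 hδH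
  have hc₀0 : 0 ≤ c₀ := by rw [hc₀]; positivity
  have hΛ0 : 0 ≤ Λ := by rw [hΛ]; positivity
  have hpsd : ∀ z : ((Fin d → ZMod M) × (Fin d → Fin L)) × o → ℝ, 0 ≤ z ⬝ᵥ (Hf *ᵥ z) := fun z =>
    (mul_nonneg hwf.le (Finset.sum_nonneg fun e _ => dotProduct_self_nonneg' _)).trans (hHf z)
  have hK := coercive_K hL hR hW hWstep hQ hHsym hwf hwf' hHf hHf' ha
  rw [← hγK] at hK
  have hUB := ub_lattice (Q := Q) hL hR hW hQ hwf' hHf'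
  rw [← hΛ] at hUB
  have hP := abs_blockProp_le_lattice hL hR hW hWstep hQ hHsym hwf hwf' hHf hHf' ha hh₀ hδH hHent hγK hcK hrF
  rw [← hc₀] at hP
  have h := abs_effForm_le hprofU isPseudoDist_unit (fun s hs b => sum_exp_unit_le hs b.1) hHsym hpsd ha hγpos hK hΛ0 hUB hc₀0 hrFpos hP b b'
  rwa [← hrU] at h

/-- **`abs_minOp_le_lattice` — THE HARD MINIMISER OF THE ONE-STEP BLOCK LATTICE HAS LOCALISED COLUMNS, EVERY BACKGROUND, EVERY TORUS** [our proof; PART 105 `abs_minOp_le`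
with the same letters plus `σ(p,b) = tdist(p.1.1, b.1)`, its compatibility with `ρ` (torus triangle inequality) and `hKQ` := PART 109 `abs_Kinv_mul_transpose_le_lattice`]:
`|ℋ(p,b)| ≤ 2(Λ+a)·(|o|·2∕γ_K)·(|o|·K_d(m∕2))·e^{−(m∕2)·tdist(p.1.1,b.1)}`, `m = min r_F r_U`. -/
theorem abs_minOp_le_lattice (hL : 0 < L) {R : ((Fin d → ZMod M) × (Fin d → Fin L)) × Fin d → Matrix o o ℝ} (hR : ∀ e, (R e)ᵀ * R e = 1)
    (hW : ∀ y x, (W y x)ᵀ * W y x = 1)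
    (hWstep : ∀ (y : Fin d → ZMod M) (z : Fin d → Fin L) (μ : Fin d) (h : (z μ : ℕ) + 1 < L), (∀ ν, μ < ν → (z ν : ℕ) = 0) →
      W y (y, update z μ ⟨(z μ : ℕ) + 1, h⟩) = W y (y, z) * R ((y, z), μ))
    (hQ : ∀ (u : ((Fin d → ZMod M) × (Fin d → Fin L)) × o → ℝ) (y : Fin d → ZMod M),
      (fun a => (Q *ᵥ u) (y, a)) = ∑ x, (if x.1 = y then ((L : ℝ) ^ d)⁻¹ else 0) • (W y x *ᵥ fun b => u (x, b)))
    (hHsym : Hfᵀ = Hf) {wf wf' : ℝ} (hwf : 0 < wf) (hwf' : 0 ≤ wf')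
    (hHf : ∀ u : ((Fin d → ZMod M) × (Fin d → Fin L)) × o → ℝ,
      wf * ∑ e : ((Fin d → ZMod M) × (Fin d → Fin L)) × Fin d,
        ((R e *ᵥ fun b => u ((e.1.1 + ((((e.1.2 e.2 : ℕ) + 1) / L) • (Pi.single e.2 (1 : ZMod M))),
            update e.1.2 e.2 ⟨((e.1.2 e.2 : ℕ) + 1) % L, Nat.mod_lt _ hL⟩), b)) - fun b => u (e.1, b)) ⬝ᵥ
          ((R e *ᵥ fun b => u ((e.1.1 + ((((e.1.2 e.2 : ℕ) + 1) / L) • (Pi.single e.2 (1 : ZMod M))),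
            update e.1.2 e.2 ⟨((e.1.2 e.2 : ℕ) + 1) % L, Nat.mod_lt _ hL⟩), b)) - fun b => u (e.1, b)) ≤ u ⬝ᵥ (Hf *ᵥ u))
    (hHf' : ∀ u : ((Fin d → ZMod M) × (Fin d → Fin L)) × o → ℝ, u ⬝ᵥ (Hf *ᵥ u) ≤
      wf' * ∑ e : ((Fin d → ZMod M) × (Fin d → Fin L)) × Fin d,
        ((R e *ᵥ fun b => u ((e.1.1 + ((((e.1.2 e.2 : ℕ) + 1) / L) • (Pi.single e.2 (1 : ZMod M))),
            update e.1.2 e.2 ⟨((e.1.2 e.2 : ℕ) + 1) % L, Nat.mod_lt _ hL⟩), b)) - fun b => u (e.1, b)) ⬝ᵥ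
          ((R e *ᵥ fun b => u ((e.1.1 + ((((e.1.2 e.2 : ℕ) + 1) / L) • (Pi.single e.2 (1 : ZMod M))),
            update e.1.2 e.2 ⟨((e.1.2 e.2 : ℕ) + 1) % L, Nat.mod_lt _ hL⟩), b)) - fun b => u (e.1, b)))
    {a h₀ δH : ℝ} (ha : 0 < a) (hh₀ : 0 ≤ h₀) (hδH : 0 < δH)
    (hHent : ∀ p q : ((Fin d → ZMod M) × (Fin d → Fin L)) × o, |Hf p q| ≤
      h₀ * Real.exp (-(δH * tdist (fun _ : Fin d => M) (fun i => (ZMod.finEquiv M).symm (p.1.1 i)) (fun i => (ZMod.finEquiv M).symm (q.1.1 i)))))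
    {γK cK rF c₀ Λ rU : ℝ}
    (hγK : γK = (max (4 * (4 * (d * ((L : ℝ) - 1)) ^ 2 * (L : ℝ) ^ d / wf))
        ((16 * d * (4 * (d * ((L : ℝ) - 1)) ^ 2 * (L : ℝ) ^ d / wf) * wf' * (L : ℝ) ^ d + 2 * (L : ℝ) ^ d) / a))⁻¹)
    (hcK : cK = h₀ + a * Fintype.card o * (((L : ℝ) ^ d)⁻¹) ^ 2)
    (hrF : rF = rate (fun s => Fintype.card o * (L : ℝ) ^ d * latticeConst d s) γK cK δH)
    (hc₀ : c₀ = (Fintype.card o : ℝ) ^ 2 * (2 / γK)) (hΛ : Λ = 4 * d * wf' * (L : ℝ) ^ d)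
    (hrU : rU = rate (fun s => Fintype.card o * latticeConst d s) (Λ + a)⁻¹ c₀ rF)
    {m : ℝ} (hm : m = min rF rU)
    (p : ((Fin d → ZMod M) × (Fin d → Fin L)) × o) (b : (Fin d → ZMod M) × o) :
    |minOp Hf Q p b| ≤ 2 * (Λ + a) * (Fintype.card o * (2 / γK)) * (Fintype.card o * latticeConst d (m / 2)) *
      Real.exp (-(m / 2 * tdist (fun _ : Fin d => M) (fun i => (ZMod.finEquiv M).symm (p.1.1 i)) (fun i => (ZMod.finEquiv M).symm (b.1 i)))) := by
  have hγpos : 0 < γK := by rw [hγK]; exact gammaK_pos hL hwf hwf' ha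
  have hcK0 : 0 ≤ cK := by rw [hcK]; positivity
  have hLd : 0 < (L : ℝ) ^ d := pow_pos (Nat.cast_pos.mpr hL) d
  have hprofF : ∀ s : ℝ, 0 < s → 0 ≤ Fintype.card o * (L : ℝ) ^ d * latticeConst d s := fun s hs => by
    have := latticeConst_nonneg d hs.le; positivity
  have hprofU : ∀ s : ℝ, 0 < s → 0 ≤ (Fintype.card o : ℝ) * latticeConst d s := fun s hs => by
    have := latticeConst_nonneg d hs.le; positivity
  have hrFpos : 0 < rF := by rw [hrF]; exact rate_pos hprofF hγpos hcK0 hδH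
  have hc₀0 : 0 ≤ c₀ := by rw [hc₀]; positivity
  have hΛ0 : 0 ≤ Λ := by rw [hΛ]; positivity
  have hpsd : ∀ z : ((Fin d → ZMod M) × (Fin d → Fin L)) × o → ℝ, 0 ≤ z ⬝ᵥ (Hf *ᵥ z) := fun z =>
    (mul_nonneg hwf.le (Finset.sum_nonneg fun e _ => dotProduct_self_nonneg' _)).trans (hHf z)
  have hK := coercive_K hL hR hW hWstep hQ hHsym hwf hwf' hHf hHf' ha
  rw [← hγK] at hK
  have hUB := ub_lattice (Q := Q) hL hR hW hQ hwf' hHf'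
  rw [← hΛ] at hUB
  have hP := abs_blockProp_le_lattice hL hR hW hWstep hQ hHsym hwf hwf' hHf hHf' ha hh₀ hδH hHent hγK hcK hrF
  rw [← hc₀] at hP
  have hKQ := abs_Kinv_mul_transpose_le_lattice hL hR hW hWstep hQ hHsym hwf hwf' hHf hHf' ha hh₀ hδH hHent hγK hcK hrF
  have hc₁ : 0 ≤ (Fintype.card o : ℝ) * (2 / γK) := by positivity
  have h := abs_minOp_le hprofU isPseudoDist_unit (fun s hs b => sum_exp_unit_le hs b.1) hHsym hpsd ha hγpos hK hΛ0 hUB hc₀0 hrFpos hP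
    (σ := fun (p : ((Fin d → ZMod M) × (Fin d → Fin L)) × o) (b : (Fin d → ZMod M) × o) =>
      tdist (fun _ : Fin d => M) (fun i => (ZMod.finEquiv M).symm (p.1.1 i)) (fun i => (ZMod.finEquiv M).symm (b.1 i)))
    (fun p b => tdist_nonneg _ _ _) (fun p b b' => tdist_triangle one_le_const _ _ _) hc₁ hrFpos hKQ p b
  rw [← hrU, ← hm] at h
  exact h

end Summit.QuantumFields.BalabanUV.Beta.GAN24.EffectiveFormLocalisationLatticeEnd

end
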